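import Summits.QuantumFields.YangMills.Theorems.UnitScaleTiltProp7OneFormGreenSupBound
import Summits.QuantumFields.YangMills.Theorems.UnitScaleTiltProp7OneFormAgmonLocal
import Summits.QuantumFields.YangMills.Theorems.UnitScaleTiltProp7LandauDictT3
import HarnessLib

/-!
# Route `UnitScaleTilt`, crux K1 «MinimiserStabilityRegPr» (stmt-QuantumFields-19200), EX face, norm_G ∕ h133 road — N6 FILE D letter (dκ), part 2 of 3:
# **THE LETTERS OF THE DECAYED DIVERGENCE ROW** — (i) the covariant divergence `D*_{U₀}` of a one-form is the sum over `μ` of the BACKWARD covariant differences of its components, each a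
# unitary transport of the FORWARD one on the bond `⟨x−e_μ, μ⟩`, so `‖(D*A)(x)‖ ≤ Σ_μ ‖(D A_μ)(⟨x−e_μ,μ⟩)‖` with NO `η⁻¹` paid (§1); (ii) the local pair `η⁻²(Δ′₁ − 𝒦)` reads the radius-2
# stencil only, so it maps a decaying field to a decaying field (§2); (iii) the block-`L²` decay of `G₀X` for a block-supported source (px16's §3 step, exported) and, through a displayed
# kernel row, the decayed (D)∕(Q) words (§3); (iv) the divergence of a one-form whose components have decaying covariant gradients decays (§4).
# (★p1 g27 CHAIR WORD №30 (2)∕(3) «(dκ) N5-blk»; px16 g13 10:39:50Z «GO — (dκ) IS YOURS» + pointers; px5 g13 10:35:44Z road; width seat `ym3-torus-px21` g15.)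

Cell `ym3-torus` (HUMAN RULING D-0037; rung R3 = SU(2) YM₃ on T³ — NOT d = 4, NOT infinite volume, NOT a mass gap, NOT Clay).  THEOREMS ONLY (0 `def`, 0 `sorry`, default heartbeats);
`--supports stmt-QuantumFields-19200 --as helper`; count-neutral.

WHAT IS PROVED (ns `Summit.QuantumFields.YangMills.Theorems.Prop7OneFormGreenBlockDivergenceLetters`; member `F`, `n ≤ K` implicit in the carriers, `ℓ = L^{K−n}`, `B = iterBlockOf (K−n)`).
* §1 `covDerivT_eq_neg_conjR_covDerivFwdT` (lit ✓`covDerivT` = `−R(V⁻¹)`∘lit ✓`covDerivFwdT` one site back, any member∕background) · ★ `norm_symm_DstarL2_toL2_le_sum`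
  (`‖toL2S⁻¹(D*_{U₀}(toL2 A)) x‖ ≤ Σ_μ ‖toL2⁻¹(D_{U₀}(toL2S A_μ)) ⟨x−e_μ, μ⟩‖`; ✓`DstarL2_toL2_eq_covDivFormT`, ✓`DL2_toL2S_eq_covDerivFwdT`, lit ✓`B8Ineq132.norm_conjR_le` on `U1`).
* §2 ★ `norm_local_pair_le_of_localSup` (O1 ✓`norm_local_remainder_le_of_regPr` on the field truncated to the stencil — px21 g14 ✓`deltaPrimeOp_congr_of_agree`∕✓`curvOp_congr_of_agree`) ·
  `tdist_iterBlockOf_le_add_three` (`d(B x, B x′) ≤ tdist(x,x′) + 3`, crude ✓`tdist_iterBlockOf_le`) · ★ `norm_local_pair_le_of_decay` (`≤ 32ε₀·(A e^{5κ})·e^{−κ d(B b₋, z)}`).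
* §3 ★ `blockL2Decay_GT_of_letters` (`‖toL2(1_{B=y}·toL2⁻¹(G₀(toL2 X)))‖ ≤ (e^{6r}√(2c₀dℓ^d)∕Θ)·s·e^{−r·tdist(y,z)}` from (γ)(C_V)(θ_V)∕`0 < Θ`∕`PosOnto`, A4-all ✓`blockDecay_allBlocks_of_letters`) ·
  ★ `norm_word_le_of_kernelRow_blockDecay` (✓`norm_symm_apply_le_of_kernelRow_blockDecay` read at `toL2⁻¹u`).
* §4 `exp_unshift_le` (`e^{−κ d(B(x−e_μ),z)} ≤ e^{4κ}·e^{−κ d(B x,z)}`) · ★★ `norm_symm_DstarL2_le_of_componentDecay` (components' gradients `≤ M·e^{−κd}` ⟹ divergence `≤ 3e^{4κ}M·e^{−κd}`).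
HYP-SAT (★★OWNER RULING №42).  `RegPr` (§2); the one-form letters of N4 §2 VERBATIM (§3: `hco hVlow hVconj`, `0 < Θ`, `PosOnto`); a displayed kernel row (§3, the `h349`∕`hk_Q` member texts); decayed-row
schemas (§4) — all real-inequality schemas inhabited in the tree (px16 ✓`norm_symm_GT_apply_le_of_blockSupport`, ✓`kernelRow349_allMembers_exists`, px21 ✓`hkQ_of_regPr`); no `Prop` placeholder.
HONEST SCOPE.  Letters∕bookkeeping; nothing of (dκ) proper (part 3), FILE D, `norm_G`, `h133`, the EX rows, EX or the crux is proved here; the Yang–Mills mass gap is NOT proved.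

References: T. Bałaban, CMP **99** (1985) 389–434 [Balaban1985BackgroundPropagators] ((3.3) p.391, (3.8)–(3.11) p.392, (3.26)–(3.27) p.395, Thm 3.1 (3.42)–(3.46) pp.397–398, (3.49) p.399,
Thm 3.12 p.422); CMP **102** (1985) 277–309 [Balaban1985Variational] ((14) p.280, (19) p.281, (134)–(136) p.298); CMP **122** (1989) 175–202 [Balaban1985RegularSpaces] ((1.1)–(1.2) p.76);
CMP **98** (1985) 17–51 [Balaban1985Averaging] ((2) p.17).
-/

set_option autoImplicit false

noncomputable section

open scoped BigOperators Matrix.Norms.L2Operator InnerProductSpace ComplexConjugate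

namespace Summit.QuantumFields.YangMills.Theorems.Prop7OneFormGreenBlockDivergenceLetters

open Literature.MathematicalPhysics.QuantumFieldTheory.Balaban1983to89
open Literature.MathematicalPhysics.QuantumFieldTheory.Balaban1983to89.T3ContinuumYM3Torus
open Literature.MathematicalPhysics.QuantumFieldTheory.Balaban1983to89.T3PrintedRegularMinimiser (RegPr)
open T3SectALandauChart (formComp bgUnits covDerivFwdT covDivFormT eta eta_pos)
open B10Eq68TorusRegularity (covDerivT)
open B7Eq78Linearization (conjR conjR_apply conjR_sub conjR_smul_real)
open B7Prop1Explicit (U1)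
open B4Sect5Torus (TSite)
open B9SectCLatticeCarrier (Bond)
open B9TorusCalculus (torusT torusT_apply torusT_symm_apply)
open B9Eq310Hermitian (deltaPrimeOp)
open B11Eq135Weitzenbock (curvOp)
open B9Eq311L2Pairing (WL2)
open B11Eq103H1Complex (BondL2K SiteL2K)
open B5Eq118OneStroke (iterBlockOf)
open B3Taylor310LocalRemainder (tdist_comm tdist_triangle)
open Summit.QuantumFields.Balaban3D.Proofs.Run3Collar (tdist_shift_le)
open Summit.QuantumFields.YangMills.Theorems.Prop7SectET3Transport (periodsT3 siteEquiv bondEquiv)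
open Summit.QuantumFields.YangMills.Theorems.Prop7SectET3HilbertLetters (W₂ frobEquiv toL2 toL2S DL2 DstarL2 covLapSite toL2_apply toL2_symm_apply toL2S_apply)
open Summit.QuantumFields.YangMills.Theorems.Prop7LandauDict (DL2_toL2S_eq_covDerivFwdT DstarL2_toL2_eq_covDivFormT)
open Summit.QuantumFields.YangMills.Theorems.Prop7OneFormAgmonLocal (deltaPrimeOp_congr_of_agree curvOp_congr_of_agree tdist_le_two_of_stencil)
open Summit.QuantumFields.YangMills.Theorems.Prop7OneFormKatoForm (norm_local_remainder_le_of_regPr)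
open Summit.QuantumFields.YangMills.Theorems.Prop7SectET3WilsonHessian (DeltaEta DeltaEtaSlot)
open Summit.QuantumFields.YangMills.Theorems.Prop7SectET3GaugeProjector (RS)
open Summit.QuantumFields.YangMills.Theorems.Prop7SectET3CurvedPropagators (laplaceA Qk GT PosOnto laplaceA_GT)
open Summit.QuantumFields.YangMills.Theorems.Prop7RieszTauFrobNorm (norm_frobEquiv_le norm_frobEquiv_symm_le)
open Summit.QuantumFields.YangMills.Theorems.Prop7OneFormGreenSupBound (norm_toL2_blockPiece_le)
open Summit.QuantumFields.YangMills.Theorems.Prop7OneFormBlockDecayAll (blockDecay_allBlocks_of_letters eta_sq_exp_sub_one_sq_le)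
open Summit.QuantumFields.YangMills.Theorems.Prop7OneFormRemainderDecay (norm_symm_apply_le_of_kernelRow_blockDecay)
open Summit.QuantumFields.YangMills.Theorems.Prop7OneFormDecayData (norm_le_mul_exp_neg_of_support)

variable (F : T3Family) {n K : ℕ} (c₀ : ℝ) [Fact (0 < c₀)] (U₀ : GaugeField (F.P K) 0 (Matrix.specialUnitaryGroup (Fin 2) ℂ))

/-! ## §1 The covariant divergence is a sum of conjugated covariant gradients of the components -/

section Stencil

variable {P : Params} {s : ℕ}

/-- **BACKWARD = MINUS CONJUGATED FORWARD**: `(D^{η*}_{V,μ}G)(x) = −R(V(x−e_μ,x))⁻¹·(D^η_{V,μ}G)(x−e_μ)` — the backward covariant difference at `x` is the forward one on the bond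
`⟨x−e_μ, μ⟩`, transported back (lit ✓`covDerivT` vs ✓`covDerivFwdT`, `(x − e_μ) + e_μ = x`). [cite: Balaban1985RegularSpaces, (1.1) p.76; Balaban1985BackgroundPropagators, (3.3)∕(3.8) pp.391–392] -/
theorem covDerivT_eq_neg_conjR_covDerivFwdT (η : ℝ) (V : GaugeField P s (Matrix (Fin 2) (Fin 2) ℂ)ˣ) (μ : Fin P.d)
    (G : Site P s → Matrix (Fin 2) (Fin 2) ℂ) (x : Site P s) :
    covDerivT η V μ G x = -conjR (V ⟨x.unshift μ, μ⟩)⁻¹ (covDerivFwdT η V μ G (x.unshift μ)) := by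
  unfold covDerivT covDerivFwdT
  rw [Site.shift_unshift, conjR_smul_real, ← smul_neg, conjR_sub, neg_sub]
  congr 1
  rw [conjR_apply, conjR_apply, conjR_apply, inv_inv]
  simp only [mul_assoc, Units.inv_mul, mul_one, Units.inv_mul_cancel_left]

end Stencil

/-- ★ **THE COVARIANT DIVERGENCE IS DOMINATED BY THE COMPONENTS' COVARIANT GRADIENTS ONE SITE BACK**: for every bond field `A` and site `x`,
`‖(toL2S⁻¹(D*_{U₀}(toL2 A)))(x)‖ ≤ Σ_μ ‖(toL2⁻¹(D_{U₀}(toL2S A_μ)))(⟨x−e_μ, μ⟩)‖` — (3.8) is `Σ_μ` of backward covariant differences of the components (✓`DstarL2_toL2_eq_covDivFormT`), each the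
forward one transported by a unitary (✓`DL2_toL2S_eq_covDerivFwdT`, §1, lit ✓`norm_conjR_le` on `U1`); NO `η⁻¹` is paid. [cite: Balaban1985BackgroundPropagators, (3.3) p.391, (3.8) p.392] -/
theorem norm_symm_DstarL2_toL2_le_sum (A : PBond (F.P K) 0 → Matrix (Fin 2) (Fin 2) ℂ) (x : Site (F.P K) 0) :
    ‖(toL2S F K c₀).symm (DstarL2 F n K c₀ U₀ (toL2 F K c₀ A)) x‖
      ≤ ∑ μ : Fin (F.P K).d, ‖(toL2 F K c₀).symm (DL2 F n K c₀ U₀ (toL2S F K c₀ (formComp A μ))) ⟨x.unshift μ, μ⟩‖ := by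
  rw [DstarL2_toL2_eq_covDivFormT]
  unfold covDivFormT
  refine (norm_sum_le _ _).trans (Finset.sum_le_sum fun μ _ => ?_)
  rw [covDerivT_eq_neg_conjR_covDerivFwdT, norm_neg, DL2_toL2S_eq_covDerivFwdT]
  have hU1 : (bgUnits F K U₀ ⟨x.unshift μ, μ⟩)⁻¹ ∈ U1 (Matrix (Fin 2) (Fin 2) ℂ) :=
    Subgroup.inv_mem _ (B11Thm1LevelZero.unitsField_toUField_mem_U1 U₀ _)
  exact B8Ineq132.norm_conjR_le hU1 _

/-! ## §2 The local pair `η⁻²(Δ′₁ − 𝒦)` reads the radius-2 ball only -/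

/-- ★ **THE LOCAL PAIR IS CONTROLLED BY A LOCAL SUP**: at `RegPr F n K ε₀ U₀`, if `‖W b′‖ ≤ m` for the bonds `b′` with `tdist(b₋, b′₋) ≤ 2`, then
`‖(η⁻²(Δ′₁ − 𝒦)W)(b)‖ ≤ 32ε₀·m` — O1's sup letter ✓`norm_local_remainder_le_of_regPr` on the field TRUNCATED to the stencil of `b` (px21 g14 ✓`deltaPrimeOp_congr_of_agree`∕✓`curvOp_congr_of_agree`:
same value; ✓`tdist_le_two_of_stencil`: the stencil lies in the ball). [cite: Balaban1985Variational, (14) p.280, (135)–(136) p.298; Balaban1985BackgroundPropagators, (3.10) p.392] -/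
theorem norm_local_pair_le_of_localSup {ε₀ : ℝ} (hreg : RegPr F n K ε₀ U₀) (W : PBond (F.P K) 0 → Matrix (Fin 2) (Fin 2) ℂ) (b : PBond (F.P K) 0)
    {m : ℝ} (hm : 0 ≤ m) (hW : ∀ b' : PBond (F.P K) 0, Site.tdist b.src b'.src ≤ 2 → ‖W b'‖ ≤ m) :
    ‖(eta F n K)⁻¹ • (eta F n K)⁻¹ •
        (deltaPrimeOp (torusT (F.P K) 0) (fun μ x => bgUnits F K U₀ ⟨x, μ⟩) 1 (formComp W) b.dir b.src
          - curvOp (torusT (F.P K) 0) (fun μ x => bgUnits F K U₀ ⟨x, μ⟩) (formComp W) b.dir b.src)‖ ≤ 32 * ε₀ * m := by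
  classical
  set x := b.src with hx
  set μ := b.dir with hμ
  set Z : PBond (F.P K) 0 → Matrix (Fin 2) (Fin 2) ℂ := fun b' =>
    if (b'.src = x ∨ ∃ ν : Fin (F.P K).d, b'.src = x.shift ν ∨ b'.src = x.unshift ν ∨ b'.src = (x.unshift ν).shift μ ∨ b'.src = (x.shift μ).unshift ν)
    then W b' else 0 with hZ
  -- the sup of the truncated field
  have hZle : ∀ b' : PBond (F.P K) 0, ‖Z b'‖ ≤ m := by
    intro b'
    by_cases hst : (b'.src = x ∨ ∃ ν : Fin (F.P K).d, b'.src = x.shift ν ∨ b'.src = x.unshift ν ∨ b'.src = (x.unshift ν).shift μ ∨ b'.src = (x.shift μ).unshift ν)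
    · simp only [hZ, if_pos hst]
      exact hW b' (tdist_le_two_of_stencil F x μ b'.src hst)
    · simp only [hZ, if_neg hst, norm_zero]
      exact hm
  -- the truncated field agrees with `W` on the stencil
  have hag : ∀ (κ : Fin (F.P K).d) (y : Site (F.P K) 0),
      (y = x ∨ ∃ ν : Fin (F.P K).d, y = x.shift ν ∨ y = x.unshift ν ∨ y = (x.unshift ν).shift μ ∨ y = (x.shift μ).unshift ν) →
      formComp Z κ y = formComp W κ y := by
    intro κ y hy
    show Z ⟨y, κ⟩ = W ⟨y, κ⟩
    simp only [hZ]
    rw [if_pos hy]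
  have hΔ : deltaPrimeOp (torusT (F.P K) 0) (fun μ x => bgUnits F K U₀ ⟨x, μ⟩) 1 (formComp Z) b.dir b.src
      = deltaPrimeOp (torusT (F.P K) 0) (fun μ x => bgUnits F K U₀ ⟨x, μ⟩) 1 (formComp W) b.dir b.src := by
    refine deltaPrimeOp_congr_of_agree _ _ 1 b.dir b.src (fun κ => hag κ _ (Or.inl hx.symm)) (fun κ ν => hag κ _ ?_) (fun κ ν => hag κ _ ?_) (fun κ ν => hag κ _ ?_)
    · exact Or.inr ⟨ν, Or.inl (by rw [torusT_apply, hx])⟩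
    · exact Or.inr ⟨ν, Or.inr (Or.inl (by rw [torusT_symm_apply, hx]))⟩
    · exact Or.inr ⟨ν, Or.inr (Or.inr (Or.inl (by rw [torusT_symm_apply, torusT_apply, hx, hμ])))⟩
  have hK : curvOp (torusT (F.P K) 0) (fun μ x => bgUnits F K U₀ ⟨x, μ⟩) (formComp Z) b.dir b.src
      = curvOp (torusT (F.P K) 0) (fun μ x => bgUnits F K U₀ ⟨x, μ⟩) (formComp W) b.dir b.src :=
    curvOp_congr_of_agree _ _ b.dir b.src fun κ ν => hag κ _ (Or.inr ⟨ν, Or.inr (Or.inr (Or.inr (by rw [torusT_symm_apply, torusT_apply, hx, hμ])))⟩)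
  have hO1 := norm_local_remainder_le_of_regPr F (n := n) U₀ hreg hZle b
  rw [hΔ, hK] at hO1
  exact hO1

omit [Fact (0 < c₀)] in
/-- **ADJACENT FINE SITES LIE IN ADJACENT-OR-EQUAL BLOCKS, CRUDELY**: `d(B x, B x′) ≤ tdist(x, x′) + 3` (✓`tdist_iterBlockOf_le`: `≤ tdist∕ℓ + d`, and `a∕ℓ ≤ a`).
[cite: Balaban1985Averaging, (2) p.17] -/
theorem tdist_iterBlockOf_le_add_three (x x' : Site (F.P K) 0) :
    (Site.tdist (P := F.P K) (iterBlockOf (K - n) x) (iterBlockOf (K - n) x') : ℝ) ≤ (Site.tdist x x' : ℝ) + 3 := by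
  have hk : K - n ≤ (F.P K).m + (F.P K).K := by show K - n ≤ F.m + K; omega
  have h := Prop7BlockDistanceWeights.tdist_iterBlockOf_le hk x x'
  have hd : (F.P K).d = 3 := rfl
  have h2 : Site.tdist x x' / (F.P K).L ^ (K - n) ≤ Site.tdist x x' := Nat.div_le_self _ _
  have h3 : Site.tdist (P := F.P K) (iterBlockOf (K - n) x) (iterBlockOf (K - n) x') ≤ Site.tdist x x' + 3 := by omega
  exact_mod_cast h3

/-- ★ **THE LOCAL PAIR OF A DECAYING FIELD DECAYS**: at `RegPr`, if `‖W b‖ ≤ A·e^{−κ·d(B b₋, z)}` everywhere (`κ ≥ 0`), then `‖(η⁻²(Δ′₁ − 𝒦)W)(b)‖ ≤ 32ε₀·(A·e^{5κ})·e^{−κ·d(B b₋, z)}`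
(the radius-2 stencil reaches blocks at coarse distance `≤ 5`). [cite: Balaban1985Variational, (14) p.280, (135)–(136) p.298; Balaban1985BackgroundPropagators, (3.10) p.392, (3.46) p.398] -/
theorem norm_local_pair_le_of_decay {ε₀ : ℝ} (hreg : RegPr F n K ε₀ U₀) (W : PBond (F.P K) 0 → Matrix (Fin 2) (Fin 2) ℂ)
    (z : Site (F.P K) (K - n)) {κ A : ℝ} (hκ : 0 ≤ κ) (hA : 0 ≤ A)
    (hW : ∀ b : PBond (F.P K) 0, ‖W b‖ ≤ A * Real.exp (-(κ * (Site.tdist (P := F.P K) (iterBlockOf (K - n) b.src) z : ℝ)))) (b : PBond (F.P K) 0) :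
    ‖(eta F n K)⁻¹ • (eta F n K)⁻¹ •
        (deltaPrimeOp (torusT (F.P K) 0) (fun μ x => bgUnits F K U₀ ⟨x, μ⟩) 1 (formComp W) b.dir b.src
          - curvOp (torusT (F.P K) 0) (fun μ x => bgUnits F K U₀ ⟨x, μ⟩) (formComp W) b.dir b.src)‖
      ≤ 32 * ε₀ * ((A * Real.exp (5 * κ)) * Real.exp (-(κ * (Site.tdist (P := F.P K) (iterBlockOf (K - n) b.src) z : ℝ)))) := by
  refine norm_local_pair_le_of_localSup F U₀ hreg W b (by positivity) fun b' hb' => (hW b').trans ?_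
  -- `d(B b′₋, z) ≥ d(B b₋, z) − 5`
  have h1 := tdist_iterBlockOf_le_add_three F (n := n) b.src b'.src
  have h2 : (Site.tdist b.src b'.src : ℝ) ≤ 2 := by exact_mod_cast hb'
  have h3 : (Site.tdist (P := F.P K) (iterBlockOf (K - n) b.src) z : ℝ)
      ≤ (Site.tdist (P := F.P K) (iterBlockOf (K - n) b.src) (iterBlockOf (K - n) b'.src) : ℝ) + (Site.tdist (P := F.P K) (iterBlockOf (K - n) b'.src) z : ℝ) := by
    exact_mod_cast tdist_triangle (iterBlockOf (K - n) b.src) (iterBlockOf (K - n) b'.src) z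
  have h4 : -(κ * (Site.tdist (P := F.P K) (iterBlockOf (K - n) b'.src) z : ℝ)) ≤ 5 * κ + -(κ * (Site.tdist (P := F.P K) (iterBlockOf (K - n) b.src) z : ℝ)) := by
    nlinarith
  calc A * Real.exp (-(κ * (Site.tdist (P := F.P K) (iterBlockOf (K - n) b'.src) z : ℝ)))
      ≤ A * Real.exp (5 * κ + -(κ * (Site.tdist (P := F.P K) (iterBlockOf (K - n) b.src) z : ℝ))) := mul_le_mul_of_nonneg_left (Real.exp_le_exp.2 h4) hA
    _ = _ := by rw [Real.exp_add]; ring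


/-! ## §3 The block-`L²` decay of `G₀X` from the letters (px16's §3 step, exported) and the decayed (D)∕(Q) words -/

variable {h : n ≤ K} {cB a : ℝ} [Fact (0 < cB)]

/-- ★ **THE BLOCK-`L²` DECAY OF `G₀X` FOR A BLOCK-SUPPORTED SOURCE** (A4-all ✓`blockDecay_allBlocks_of_letters` at the slot of record, the `η`-bracket majorised by ✓`eta_sq_exp_sub_one_sq_le`,
the source mass by ✓`norm_toL2_blockPiece_le`): `‖toL2(1_{B=y}·toL2⁻¹(G₀(toL2 X)))‖ ≤ (e^{6r}√(2c₀dℓ^d)∕Θ)·s·e^{−r·tdist(y, z)}` — the `hD` that px16's §3 proof builds internally, as a lemma.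
[cite: Balaban1985BackgroundPropagators, Thm 3.1 (3.42) p.397, Thm 3.12 p.422] -/
theorem blockL2Decay_GT_of_letters (hnK : n ≤ K) (hp : PosOnto F n K h c₀ cB a (DeltaEtaSlot F n K c₀) U₀)
    {r : ℝ} (hr : 0 < r) {γ CV θV ε : ℝ} (hε : 0 < ε) (hε1 : ε ≤ 1)
    (hco : ∀ v : BondL2K ℂ 3 (periodsT3 F K) c₀ W₂, γ * ‖v‖ ^ 2 ≤ RCLike.re ⟪v, laplaceA F n K h c₀ cB a (DeltaEtaSlot F n K c₀) U₀ v⟫_ℂ)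
    (hVlow : ∀ X : PBond (F.P K) 0 → Matrix (Fin 2) (Fin 2) ℂ,
      -(CV * ‖toL2 F K c₀ X‖ ^ 2) ≤ RCLike.re ⟪toL2 F K c₀ X, laplaceA F n K h c₀ cB a (DeltaEtaSlot F n K c₀) U₀ (toL2 F K c₀ X)⟫_ℂ
        - ∑ μ : Fin (F.P K).d, ‖DL2 F n K c₀ U₀ (toL2S F K c₀ (formComp X μ))‖ ^ 2)
    (hVconj : ∀ φ : Site (F.P K) 0 → ℝ, (∀ x x' : Site (F.P K) 0, |φ x - φ x'| ≤ r * eta F n K * (Site.tdist x x' : ℝ)) →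
      ∀ X : PBond (F.P K) 0 → Matrix (Fin 2) (Fin 2) ℂ,
      RCLike.re ⟪toL2 F K c₀ X, laplaceA F n K h c₀ cB a (DeltaEtaSlot F n K c₀) U₀ (toL2 F K c₀ X)⟫_ℂ
          - (∑ μ : Fin (F.P K).d, ‖DL2 F n K c₀ U₀ (toL2S F K c₀ (formComp X μ))‖ ^ 2) - θV * ‖toL2 F K c₀ X‖ ^ 2
        ≤ RCLike.re ⟪toL2 F K c₀ (fun b => Real.exp (φ b.src) • X b), laplaceA F n K h c₀ cB a (DeltaEtaSlot F n K c₀) U₀ (toL2 F K c₀ (fun b => (Real.exp (φ b.src))⁻¹ • X b))⟫_ℂ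
          - RCLike.re (∑ μ : Fin (F.P K).d, ⟪DL2 F n K c₀ U₀ (toL2S F K c₀ (formComp (fun b => Real.exp (φ b.src) • X b) μ)),
              DL2 F n K c₀ U₀ (toL2S F K c₀ (formComp (fun b => (Real.exp (φ b.src))⁻¹ • X b) μ))⟫_ℂ))
    (hΘ : 0 < ((1 - ε) * γ - ε * CV - 3 * (r ^ 2 * Real.exp (2 * r)) * (1 + 1 / ε) - θV))
    (X : PBond (F.P K) 0 → Matrix (Fin 2) (Fin 2) ℂ) (z : Site (F.P K) (K - n)) (hXz : ∀ b, X b ≠ 0 → iterBlockOf (K - n) b.src = z)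
    {s : ℝ} (hs : 0 ≤ s) (hX : ∀ b, ‖X b‖ ≤ s) (y : Site (F.P K) (K - n)) :
    ‖toL2 F K c₀ (fun b => if iterBlockOf (K - n) b.src = y then (toL2 F K c₀).symm (GT F n K h c₀ cB a (DeltaEtaSlot F n K c₀) U₀ (toL2 F K c₀ X)) b else 0)‖
      ≤ ((Real.exp (6 * r) * Real.sqrt (2 * c₀ * (((F.P K).d : ℝ) * ((((F.P K).L : ℝ) ^ (F.P K).d) ^ (K - n)))) / ((1 - ε) * γ - ε * CV - 3 * (r ^ 2 * Real.exp (2 * r)) * (1 + 1 / ε) - θV)) * s) * Real.exp (-(r * (Site.tdist y z : ℝ))) := by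
  classical
  have hc₀ : 0 < c₀ := Fact.out
  have hΘle : ((1 - ε) * γ - ε * CV - 3 * (r ^ 2 * Real.exp (2 * r)) * (1 + 1 / ε) - θV) ≤ (1 - ε) * γ - ε * CV - 3 * ((eta F n K)⁻¹) ^ 2 * (Real.exp (r * eta F n K) - 1) ^ 2 * (1 + 1 / ε) - θV := by
    have h1 := eta_sq_exp_sub_one_sq_le F n K hr.le
    have h2 : 0 ≤ 1 + 1 / ε := by positivity
    have h3 : 3 * (((eta F n K)⁻¹) ^ 2 * (Real.exp (r * eta F n K) - 1) ^ 2) * (1 + 1 / ε) ≤ 3 * (r ^ 2 * Real.exp (2 * r)) * (1 + 1 / ε) :=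
      mul_le_mul_of_nonneg_right (mul_le_mul_of_nonneg_left h1 (by norm_num)) h2
    linarith
  have hΘA : 0 ≤ (1 - ε) * γ - ε * CV - 3 * ((eta F n K)⁻¹) ^ 2 * (Real.exp (r * eta F n K) - 1) ^ 2 * (1 + 1 / ε) - θV := hΘ.le.trans hΘle
  have hu' : laplaceA F n K h c₀ cB a (DeltaEtaSlot F n K c₀) U₀ (GT F n K h c₀ cB a (DeltaEtaSlot F n K c₀) U₀ (toL2 F K c₀ X)) = toL2 F K c₀ X := laplaceA_GT hp _
  have hnf : ‖toL2 F K c₀ X‖ ≤ Real.sqrt (2 * c₀ * (((F.P K).d : ℝ) * ((((F.P K).L : ℝ) ^ (F.P K).d) ^ (K - n)))) * s := by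
    have hXeq : (fun b : PBond (F.P K) 0 => if iterBlockOf (K - n) b.src = z then X b else 0) = X := by
      funext b
      by_cases hb : iterBlockOf (K - n) b.src = z
      · rw [if_pos hb]
      · rw [if_neg hb]
        by_contra hne
        exact hb (hXz b (Ne.symm hne))
    have := norm_toL2_blockPiece_le (c₀ := c₀) X z hs hX
    rwa [hXeq] at this
  have hA4 := blockDecay_allBlocks_of_letters (h := h) (cB := cB) (a := a) (Δx := DeltaEtaSlot F n K c₀) hnK U₀ hr.le hε hε1 hco hVlow hVconj hΘA
    X z hXz _ hu' y
  have hnum : ((1 - ε) * γ - ε * CV - 3 * (r ^ 2 * Real.exp (2 * r)) * (1 + 1 / ε) - θV) * ‖toL2 F K c₀ (fun b' => if iterBlockOf (K - n) b'.src = y then (toL2 F K c₀).symm (GT F n K h c₀ cB a (DeltaEtaSlot F n K c₀) U₀ (toL2 F K c₀ X)) b' else 0)‖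
      ≤ Real.exp (6 * r) * Real.exp (-(r * (Site.tdist y z : ℝ))) * (Real.sqrt (2 * c₀ * (((F.P K).d : ℝ) * ((((F.P K).L : ℝ) ^ (F.P K).d) ^ (K - n)))) * s) :=
    (mul_le_mul_of_nonneg_right hΘle (norm_nonneg _)).trans (hA4.trans (mul_le_mul_of_nonneg_left hnf (by positivity)))
  rw [← le_div_iff₀' hΘ] at hnum
  refine hnum.trans (le_of_eq ?_)
  field_simp

/-- ★ **A DECAYED (D)- OR (Q)-WORD**: for a word `B` with the displayed kernel row `C_k·e^{−μ′·d}` (the `h349` ∕ `hk_Q` member texts) and the block-`L²` decay of a one-form `u` at rate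
`r < μ′` off the block `z`, `‖(toL2⁻¹(B u))(b)‖ ≤ C_k·√(dℓ^d∕c₀)·D·(2(1+1∕(μ′−r)))³·e^{−r·d(B b₋, z)}` — ✓`norm_symm_apply_le_of_kernelRow_blockDecay` read at `toL2⁻¹u`.
[cite: Balaban1985BackgroundPropagators, Thm 3.1 (3.42) p.397, (3.46) p.398, (3.49) p.399] -/
theorem norm_word_le_of_kernelRow_blockDecay (B : BondL2K ℂ 3 (periodsT3 F K) c₀ W₂ →ₗ[ℂ] BondL2K ℂ 3 (periodsT3 F K) c₀ W₂) {Ck μ' : ℝ} (hCk : 0 ≤ Ck)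
    (hk : ∀ (b : PBond (F.P K) 0) (Z : Matrix (Fin 2) (Fin 2) ℂ) (bd : PBond (F.P K) 0),
      ‖(toL2 F K c₀).symm (B (toL2 F K c₀ (Pi.single b Z))) bd‖
        ≤ Ck * Real.exp (-(μ' * (Site.tdist (P := F.P K) (iterBlockOf (K - n) b.src) (iterBlockOf (K - n) bd.src) : ℝ))) * ‖Z‖)
    (u : BondL2K ℂ 3 (periodsT3 F K) c₀ W₂) (z : Site (F.P K) (K - n)) {D r : ℝ} (hD0 : 0 ≤ D) (hr : 0 ≤ r) (hrμ : r < μ')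
    (hD : ∀ y : Site (F.P K) (K - n),
      ‖toL2 F K c₀ (fun b => if iterBlockOf (K - n) b.src = y then (toL2 F K c₀).symm u b else 0)‖ ≤ D * Real.exp (-(r * (Site.tdist y z : ℝ))))
    (bd : PBond (F.P K) 0) :
    ‖(toL2 F K c₀).symm (B u) bd‖
      ≤ Ck * Real.sqrt ((((F.P K).d : ℝ) * ((((F.P K).L : ℝ) ^ (F.P K).d) ^ (K - n))) / c₀) * D * (2 * (1 + 1 / (μ' - r))) ^ 3 * Real.exp (-(r * (Site.tdist (P := F.P K) (iterBlockOf (K - n) bd.src) z : ℝ))) := by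
  have h := norm_symm_apply_le_of_kernelRow_blockDecay F (n := n) B hCk hk ((toL2 F K c₀).symm u) z hD0 hr hrμ hD bd
  rwa [LinearEquiv.apply_symm_apply] at h


/-! ## §4 The divergence of a one-form whose components have decaying covariant gradients -/

omit [Fact (0 < cB)] in
/-- **ONE SITE BACK COSTS `e^{4κ}`**: `e^{−κ·d(B(x−e_μ), z)} ≤ e^{4κ}·e^{−κ·d(B x, z)}` (`tdist(x, x−e_μ) ≤ 1`, §2's crude block comparison). [cite: Balaban1985Averaging, (2) p.17] -/
theorem exp_unshift_le (z : Site (F.P K) (K - n)) {κ : ℝ} (hκ : 0 ≤ κ) (x : Site (F.P K) 0) (μ : Fin (F.P K).d) :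
    Real.exp (-(κ * (Site.tdist (P := F.P K) (iterBlockOf (K - n) (x.unshift μ)) z : ℝ))) ≤ Real.exp (4 * κ) * Real.exp (-(κ * (Site.tdist (P := F.P K) (iterBlockOf (K - n) x) z : ℝ))) := by
  have h1 := tdist_iterBlockOf_le_add_three F (n := n) x (x.unshift μ)
  have h2 : (Site.tdist x (x.unshift μ) : ℝ) ≤ 1 := by
    have := tdist_shift_le (x.unshift μ) μ
    rw [Site.shift_unshift] at this
    rw [tdist_comm]; exact_mod_cast this
  have h3 : (Site.tdist (P := F.P K) (iterBlockOf (K - n) x) z : ℝ)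
      ≤ (Site.tdist (P := F.P K) (iterBlockOf (K - n) x) (iterBlockOf (K - n) (x.unshift μ)) : ℝ)
        + (Site.tdist (P := F.P K) (iterBlockOf (K - n) (x.unshift μ)) z : ℝ) := by
    exact_mod_cast tdist_triangle (iterBlockOf (K - n) x) (iterBlockOf (K - n) (x.unshift μ)) z
  rw [← Real.exp_add]
  exact Real.exp_le_exp.2 (by nlinarith)

omit [Fact (0 < cB)] in
/-- ★ **THE DIVERGENCE FROM THE COMPONENTS' DECAYED GRADIENTS**: if `‖toL2⁻¹(D_{U₀}(toL2S W_ν)) b‖ ≤ M·e^{−κ·d(B b₋, z)}` for all `ν b`, then `‖toL2S⁻¹(D*_{U₀}(toL2 W)) x‖ ≤ 3·(e^{4κ}·M)·e^{−κ·d(B x, z)}`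
(§1 and one site back). [cite: Balaban1985BackgroundPropagators, (3.8) p.392, Thm 3.1 (3.42) p.397] -/
theorem norm_symm_DstarL2_le_of_componentDecay (W : PBond (F.P K) 0 → Matrix (Fin 2) (Fin 2) ℂ) (z : Site (F.P K) (K - n)) {κ M : ℝ} (hκ : 0 ≤ κ) (hM : 0 ≤ M)
    (hgrad : ∀ (ν : Fin (F.P K).d) (b : PBond (F.P K) 0), ‖(toL2 F K c₀).symm (DL2 F n K c₀ U₀ (toL2S F K c₀ (formComp W ν))) b‖ ≤ M * Real.exp (-(κ * (Site.tdist (P := F.P K) (iterBlockOf (K - n) b.src) z : ℝ))))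
    (x : Site (F.P K) 0) :
    ‖(toL2S F K c₀).symm (DstarL2 F n K c₀ U₀ (toL2 F K c₀ W)) x‖ ≤ 3 * (Real.exp (4 * κ) * M) * Real.exp (-(κ * (Site.tdist (P := F.P K) (iterBlockOf (K - n) x) z : ℝ))) := by
  refine (norm_symm_DstarL2_toL2_le_sum F c₀ U₀ W x).trans ?_
  calc ∑ μ : Fin (F.P K).d, ‖(toL2 F K c₀).symm (DL2 F n K c₀ U₀ (toL2S F K c₀ (formComp W μ))) ⟨x.unshift μ, μ⟩‖
      ≤ ∑ μ : Fin (F.P K).d, M * (Real.exp (4 * κ) * Real.exp (-(κ * (Site.tdist (P := F.P K) (iterBlockOf (K - n) x) z : ℝ)))) :=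
        Finset.sum_le_sum fun μ _ => (hgrad μ _).trans (mul_le_mul_of_nonneg_left (exp_unshift_le F (n := n) z hκ x μ) hM)
    _ = 3 * (Real.exp (4 * κ) * M) * Real.exp (-(κ * (Site.tdist (P := F.P K) (iterBlockOf (K - n) x) z : ℝ))) := by
        rw [Finset.sum_const, Finset.card_univ, show Fintype.card (Fin (F.P K).d) = 3 from Fintype.card_fin _, nsmul_eq_mul]
        push_cast
        ring

end Summit.QuantumFields.YangMills.Theorems.Prop7OneFormGreenBlockDivergenceLetters

end
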